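import Summits.HodgeConjecture.CorCM.Census.TwistCensusComplete

/-!
# Uniform twist generation, XX: THE ABELIAN NORMAL FORM — every finite abelian group with an involution admits a twist datum;
# hence `μ(G, c) = φ₂(G, c)` for EVERY finite abelian `G` and EVERY involution `c`

COR-CM (cell `pub-hodgecm2`), count-neutral kernel combinatorics by the binder seat b09 (gen 37; lane UNIFORM TWIST GENERATION, part XX — packaging),
on part XIX (`exists_gfaces_generate_card_eq_fibreTwo_all`) used BY NAME and Mathlibʼs structure theorem of finite abelian groups
(`AddCommGroup.equiv_directSum_zmod_of_finite`).  Theorems only: no definition, no `decide`, no certificate, no named fact, no `sorry`.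
HONEST FRAMING: `HC_CM` is NOT proved, here or anywhere in the tree; nothing here is a period or a headline.

* §1 `eq_zero_or_of_two_torsion`: in `ZMod (p^k)` (`p` prime) an element `x` with `x + x = 0` is `0`, or `p = 2`, `k ≥ 1` and `x.val = 2^{k−1}`.
* §2 **THE NORMAL FORM** (`exists_twist_datum`): for a finite abelian group `G` and an involution `c ≠ 1` there are `j ≥ 0`, a finite abelian group `B` and a
  datum `θ : G ≃ ℤ/(2·2^j) × B` with `θ (PQ) = θ P + θ Q` and `θ c = (2^j, 0)` — write `G ≅ Π_i ℤ/p_i^{k_i}`; the coordinates of `c` are `0` or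
  `2^{k_i − 1}` (`p_i = 2`); take a coordinate `i₀` of `c` with the least exponent `e = k_{i₀}` and `γ_i = 2^{k_i − e}` on the support of `c`: then
  `2^{e−1} γ = c`, `γ` has order `2^e`, and `{x : x_{i₀} = 0}` is a complement of `⟨γ⟩` (`2^j = 2^{e−1}` is the HEIGHT of `c`).
* §3 **`μ(G, c) = φ₂(G, c)` FOR EVERY FINITE ABELIAN GROUP** (`exists_gfaces_generate_card_eq_fibreTwo_of_comm`, `isLeast_card_gfaces_generate_of_comm`):
  part XIX along the datum of §2 — the lane noteʼs GRAND CONJECTURE (`HOME/pub-hodgecm2-b09/lean-g32/QUARTIC-TWIST.md` PART V) for all abelian `(G, c)`.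

## References
* [Pohlmann1968] H. Pohlmann, Algebraic cycles on abelian varieties of complex multiplication type, Ann. of Math. 88 (1968), Thm 1.
* [Milne1999] J. S. Milne, Lefschetz motives and the Tate conjecture, Compositio Math. 117 (1999), Prop. 2.1, p. 54.
-/

namespace Summit.HodgeConjecture.CorCM.Census.TwistGeneration

open Finset
open Summit.HodgeConjecture.CorCM.Prior.AllgGroup.RfwfAllgGroup
open Summit.HodgeConjecture.CorCM.Census.BlockParity
open Summit.HodgeConjecture.CorCM.Census.Coinvariant

noncomputable section

/-! ## §1 Two-torsion in `ℤ/p^k` -/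

/-- **Two-torsion in `ℤ/p^k`** (`p` prime): if `x + x = 0` then `x = 0`, or `p = 2`, `k ≥ 1` and `x.val = 2^(k−1)`. [folklore] -/
theorem eq_zero_or_of_two_torsion {p k : ℕ} (hp : p.Prime) (x : ZMod (p ^ k)) (hx : x + x = 0) :
    x = 0 ∨ (p = 2 ∧ 1 ≤ k ∧ x.val = 2 ^ (k - 1)) := by
  haveI : NeZero (p ^ k) := ⟨pow_ne_zero k hp.ne_zero⟩
  rcases Nat.eq_zero_or_pos k with hk | hk
  · subst hk
    left
    have : Subsingleton (ZMod (p ^ 0)) := by rw [pow_zero]; exact inferInstanceAs (Subsingleton (ZMod 1))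
    exact Subsingleton.elim _ _
  by_cases hx0 : x = 0
  · exact Or.inl hx0
  right
  have hval := ZMod.val_lt x
  have hval0 : x.val ≠ 0 := fun h => hx0 ((ZMod.val_eq_zero x).mp h)
  -- `p^k ∣ 2 · x.val`
  have hdvd : p ^ k ∣ 2 * x.val := by
    have h := congrArg ZMod.val hx
    rw [ZMod.val_add, ZMod.val_zero] at h
    rw [two_mul]
    exact Nat.dvd_of_mod_eq_zero h
  have hp2 : p = 2 := by
    by_contra hne
    have hcop : Nat.Coprime (p ^ k) 2 := (Nat.Coprime.pow_left k ((Nat.coprime_primes hp Nat.prime_two).mpr hne))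
    have h := hcop.dvd_of_dvd_mul_left hdvd
    have := Nat.le_of_dvd (Nat.pos_of_ne_zero hval0) h
    omega
  subst hp2
  refine ⟨rfl, hk, ?_⟩
  -- `2^(k-1) ∣ x.val < 2^k`, `x.val ≠ 0`
  set M : ℕ := 2 ^ (k - 1) with hM
  have hMpos : 0 < M := by positivity
  have h2 : 2 ^ k = 2 * M := by rw [hM, ← pow_succ']; congr 1; omega
  obtain ⟨q, hq⟩ := hdvd
  have hxq : x.val = M * q := Nat.eq_of_mul_eq_mul_left (by norm_num : 0 < 2) (by rw [hq, h2, mul_assoc])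
  have hlt : x.val < 2 * M := h2 ▸ hval
  rcases q with _ | (_ | q)
  · rw [mul_zero] at hxq; exact absurd hxq hval0
  · simpa using hxq
  · have h3 : M * 2 ≤ M * (q + 1 + 1) := Nat.mul_le_mul_left M (by omega)
    rw [← hxq] at h3
    omega

/-! ## §2 The normal form -/

/-- **THE ABELIAN NORMAL FORM.**  A finite abelian group `G` with an involution `c ≠ 1` admits a twist datum: `G ≃ ℤ/(2·2^j) × B` (multiplicative to
additive) with `c ↦ (2^j, 0)`, for some `j ≥ 0` and some finite abelian group `B`. [folklore] -/
theorem exists_twist_datum {G : Type} [CommGroup G] [Finite G] {c : G} (hc2 : c * c = 1) (hc1 : c ≠ 1) :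
    ∃ (j : ℕ) (B : Type) (_ : AddCommGroup B) (_ : Fintype B) (θ : G ≃ ZMod (2 * 2 ^ j) × B),
      (∀ P Q : G, θ (P * Q) = θ P + θ Q) ∧ θ c = (((2 ^ j : ℕ) : ZMod (2 * 2 ^ j)), 0) := by
  classical
  obtain ⟨ι, _, p, hp, k, ⟨e⟩⟩ := AddCommGroup.equiv_directSum_zmod_of_finite (Additive G)
  haveI hnz : ∀ i, NeZero (p i ^ k i) := fun i => ⟨pow_ne_zero _ (hp i).ne_zero⟩
  set E : Additive G ≃+ ((i : ι) → ZMod (p i ^ k i)) := e.trans (DirectSum.addEquivProd _) with hE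
  set c' : (i : ι) → ZMod (p i ^ k i) := E (Additive.ofMul c) with hc'
  have hcc : c' + c' = 0 := by
    rw [hc', ← map_add, ← ofMul_mul, hc2, ofMul_one, map_zero]
  have hc'0 : c' ≠ 0 := by
    intro h
    apply hc1
    have : Additive.ofMul c = 0 := E.injective (by rw [← hc', h, map_zero])
    exact this
  -- the coordinates of `c'`
  have hcoord : ∀ i, c' i = 0 ∨ (p i = 2 ∧ 1 ≤ k i ∧ (c' i).val = 2 ^ (k i - 1)) := fun i =>
    eq_zero_or_of_two_torsion (hp i) (c' i) (by have := congrFun hcc i; simpa using this)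
  set I₀ : Finset ι := univ.filter fun i => c' i ≠ 0 with hI₀
  have hI₀ne : I₀.Nonempty := by
    by_contra h
    rw [Finset.not_nonempty_iff_eq_empty] at h
    apply hc'0
    funext i
    by_contra hi
    have : i ∈ I₀ := mem_filter.mpr ⟨mem_univ _, hi⟩
    rw [h] at this
    exact absurd this (Finset.notMem_empty _)
  have hmemI₀ : ∀ i, i ∈ I₀ ↔ c' i ≠ 0 := fun i => by rw [hI₀, mem_filter]; simp
  have hsupp : ∀ i ∈ I₀, p i = 2 ∧ 1 ≤ k i ∧ (c' i).val = 2 ^ (k i - 1) := fun i hi =>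
    (hcoord i).resolve_left ((hmemI₀ i).mp hi)
  -- the least exponent on the support
  obtain ⟨i₀, hi₀, hmin⟩ := Finset.exists_min_image I₀ k hI₀ne
  obtain ⟨hp₀, hk₀, hcv₀⟩ := hsupp i₀ hi₀
  set e₀ : ℕ := k i₀ with he₀
  -- `γ`: `2^{k_i − e₀}` on the support
  set γ : (i : ι) → ZMod (p i ^ k i) := fun i => if i ∈ I₀ then ((2 ^ (k i - e₀) : ℕ) : ZMod (p i ^ k i)) else 0 with hγ
  have hγord : (p i₀ ^ k i₀) • γ = 0 := by
    funext i
    rw [Pi.smul_apply, Pi.zero_apply, hγ]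
    simp only
    split_ifs with hi
    · obtain ⟨hpi, -, -⟩ := hsupp i hi
      have hle : e₀ ≤ k i := hmin i hi
      rw [nsmul_eq_mul, ← Nat.cast_mul, ZMod.natCast_eq_zero_iff, hpi, hp₀, ← he₀, ← pow_add, show e₀ + (k i - e₀) = k i by omega]
    · rw [smul_zero]
  -- `Γ a = a • γ`, an additive map out of `ZMod (p i₀ ^ k i₀)`
  set Γ : ZMod (p i₀ ^ k i₀) →+ ((i : ι) → ZMod (p i ^ k i)) :=
    ZMod.lift (p i₀ ^ k i₀) ⟨zmultiplesHom _ γ, by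
      change ((p i₀ ^ k i₀ : ℕ) : ℤ) • γ = 0
      rw [natCast_zsmul]; exact hγord⟩ with hΓ
  have hΓval : ∀ a : ZMod (p i₀ ^ k i₀), Γ a = a.val • γ := by
    intro a
    conv_lhs => rw [← ZMod.natCast_zmod_val a, ← Int.cast_natCast, hΓ, ZMod.lift_coe]
    change ((a.val : ℕ) : ℤ) • γ = _
    rw [natCast_zsmul]
  have hγ₀ : γ i₀ = 1 := by
    rw [hγ]; simp only; rw [if_pos hi₀, ← he₀, Nat.sub_self, pow_zero, Nat.cast_one]
  have hΓ₀ : ∀ a : ZMod (p i₀ ^ k i₀), Γ a i₀ = a := by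
    intro a
    rw [hΓval, Pi.smul_apply, hγ₀, nsmul_one, ZMod.natCast_zmod_val]
  -- the complement: coordinates away from `i₀`
  let Bt : Type := (i : {i : ι // i ≠ i₀}) → ZMod (p i.1 ^ k i.1)
  let ext : Bt → ((i : ι) → ZMod (p i ^ k i)) := fun y i => if h : i = i₀ then 0 else y ⟨i, h⟩
  have hext₀ : ∀ y : Bt, ext y i₀ = 0 := fun y => by simp [ext]
  have hext : ∀ (y : Bt) (i : {i : ι // i ≠ i₀}), ext y i.1 = y i := fun y i => by
    simp only [ext, dif_neg i.2]
  have hext' : ∀ (y : Bt) (i : ι) (h : i ≠ i₀), ext y i = y ⟨i, h⟩ := fun y i h => by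
    simp only [ext, dif_neg h]
  let θ₀ : ((i : ι) → ZMod (p i ^ k i)) ≃+ ZMod (p i₀ ^ k i₀) × Bt :=
    { toFun := fun x => (x i₀, fun i => x i.1 - Γ (x i₀) i.1)
      invFun := fun ay => Γ ay.1 + ext ay.2
      left_inv := fun x => by
        funext i
        show (Γ (x i₀) + ext (fun i' => x i'.1 - Γ (x i₀) i'.1)) i = x i
        by_cases h : i = i₀
        · rw [h, Pi.add_apply, hΓ₀, hext₀ (fun i' => x i'.1 - Γ (x i₀) i'.1), add_zero]
        · rw [Pi.add_apply, hext' (fun i' => x i'.1 - Γ (x i₀) i'.1) i h]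
          abel
      right_inv := fun ay => by
        obtain ⟨a, y⟩ := ay
        have h1 : (Γ a + ext y) i₀ = a := by rw [Pi.add_apply, hΓ₀, hext₀, add_zero]
        refine Prod.ext h1 ?_
        funext i
        show (Γ a + ext y) i.1 - Γ ((Γ a + ext y) i₀) i.1 = y i
        rw [h1, Pi.add_apply, hext]
        abel
      map_add' := fun x x' => by
        refine Prod.ext rfl ?_
        funext i
        show (x + x') i.1 - Γ ((x + x') i₀) i.1 = (x i.1 - Γ (x i₀) i.1) + (x' i.1 - Γ (x' i₀) i.1)
        rw [Pi.add_apply, Pi.add_apply, map_add, Pi.add_apply]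
        abel }
  -- the cast `ZMod (p i₀ ^ k i₀) = ZMod (2 · 2^(e₀−1))`
  have hcast : p i₀ ^ k i₀ = 2 * 2 ^ (e₀ - 1) := by
    rw [hp₀, ← he₀, ← pow_succ']; congr 1; omega
  let κ : ZMod (p i₀ ^ k i₀) ≃+ ZMod (2 * 2 ^ (e₀ - 1)) := (ZMod.ringEquivCongr hcast).toAddEquiv
  let Θ : Additive G ≃+ ZMod (2 * 2 ^ (e₀ - 1)) × Bt := E.trans (θ₀.trans (AddEquiv.prodCongr κ (AddEquiv.refl Bt)))
  refine ⟨e₀ - 1, Bt, inferInstance, inferInstance, Additive.ofMul.trans Θ.toEquiv, fun P Q => ?_, ?_⟩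
  · show Θ (Additive.ofMul (P * Q)) = Θ (Additive.ofMul P) + Θ (Additive.ofMul Q)
    rw [ofMul_mul, map_add]
  · show Θ (Additive.ofMul c) = _
    have hΘ : Θ (Additive.ofMul c) = (κ (c' i₀), fun i => c' i.1 - Γ (c' i₀) i.1) := rfl
    rw [hΘ]
    refine Prod.ext ?_ ?_
    · -- first coordinate: `val = 2^(e₀ − 1)`
      show κ (c' i₀) = ((2 ^ (e₀ - 1) : ℕ) : ZMod (2 * 2 ^ (e₀ - 1)))
      apply ZMod.val_injective
      rw [show κ (c' i₀) = ZMod.ringEquivCongr hcast (c' i₀) from rfl, ZMod.ringEquivCongr_val, hcv₀, ← he₀,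
        ZMod.val_cast_of_lt (lt_mul_of_one_lt_left (by positivity) (by norm_num))]
    · -- second coordinate: `c' = Γ (c' i₀) = 2^(e₀−1) • γ`
      funext i
      show c' i.1 - Γ (c' i₀) i.1 = 0
      rw [sub_eq_zero, hΓval, Pi.smul_apply, hcv₀, hγ]
      simp only
      by_cases hi : i.1 ∈ I₀
      · obtain ⟨-, -, hcvi⟩ := hsupp i.1 hi
        have hle : e₀ ≤ k i.1 := hmin i.1 hi
        rw [if_pos hi, nsmul_eq_mul, ← Nat.cast_mul, ← pow_add, show e₀ - 1 + (k i.1 - e₀) = k i.1 - 1 by omega,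
          ← ZMod.natCast_zmod_val (c' i.1), hcvi]
      · rw [if_neg hi, smul_zero]
        by_contra hne
        exact hi ((hmemI₀ i.1).mpr hne)

/-! ## §3 `μ = φ₂` for every finite abelian group -/

/-- **`μ(G, c) = φ₂(G, c)` FOR EVERY FINITE ABELIAN GROUP `G` AND EVERY INVOLUTION `c ≠ 1`**: there is a family of rank-four face relations with EXACTLY
`φ₂(G, c)` members whose base changes generate the integer Hodge lattice modulo the pairs, and no finite family of integer Hodge vectors of fewer members
generates. [folklore] -/
theorem exists_gfaces_generate_card_eq_fibreTwo_of_comm {G : Type} [CommGroup G] [Fintype G] [DecidableEq G] {c : G}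
    (hc2 : c * c = 1) (hc1 : c ≠ 1) :
    (∃ S : Finset (CMF G c →₀ ℤ), (↑S ⊆ gfaceSet G c hc2) ∧ S.card = fibreTwo c hc2 ∧
        hodgeSpan c hc2 ≤ Submodule.span ℤ (pairSet c) ⊔ Submodule.span ℤ (translates c S)) ∧
      (∀ S : Finset (CMF G c →₀ ℤ), (↑S : Set (CMF G c →₀ ℤ)) ⊆ hodgeSpan c hc2 →
        gfaceSet G c hc2 ⊆ ↑(Submodule.span ℤ (pairSet c) ⊔ Submodule.span ℤ (translates c S)) → fibreTwo c hc2 ≤ S.card) := by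
  obtain ⟨j, B, _, _, θ, hθ, hθc⟩ := exists_twist_datum hc2 hc1
  exact exists_gfaces_generate_card_eq_fibreTwo_all (n := 2 ^ j) θ hθ hθc hc2 rfl

/-- **`μ(G, c) = φ₂(G, c)` as a least element, for every finite abelian group.** [folklore] -/
theorem isLeast_card_gfaces_generate_of_comm {G : Type} [CommGroup G] [Fintype G] [DecidableEq G] {c : G} (hc2 : c * c = 1) (hc1 : c ≠ 1) :
    IsLeast {m : ℕ | ∃ S : Finset (CMF G c →₀ ℤ), (↑S ⊆ gfaceSet G c hc2) ∧ S.card = m ∧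
      hodgeSpan c hc2 ≤ Submodule.span ℤ (pairSet c) ⊔ Submodule.span ℤ (translates c S)} (fibreTwo c hc2) := by
  obtain ⟨j, B, _, _, θ, hθ, hθc⟩ := exists_twist_datum hc2 hc1
  exact isLeast_card_gfaces_generate (n := 2 ^ j) θ hθ hθc hc2 rfl

end

end Summit.HodgeConjecture.CorCM.Census.TwistGeneration
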